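import Summits.BirchSwinnertonDyer.BirchSwinnertonDyer.Theorems.SignedLowerHalvesSmallImageLowerHalfBothSignsRttCharRoadLocalShapeRam
import Literature.NumberTheory.GaloisRepresentations.CharacterFromFrobeniusPair
import Literature.NumberTheory.EllipticCurves.CMNewformGamma0EulerFactorsPadicCharacterProofs
import HarnessLib

/-!
# Route `SignedLowerHalves`, crux L `SmallImageLowerHalfBothSigns` (stmt-BirchSwinnertonDyer-23599), line `rtt_w3`: DE-CITE of the Ribet (BAD)
# conjunct, FILE 2 of 3 — the `p`-adic AVATAR pinned to `ψ` off `p·𝔪` IS the avatar of the primitive companion: ramification exactly at the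
# conductor, Frobenius values `ψ₀` at every other prime away from `p` (INPUTS seat `bsd-inputs-honda-p1` g33; THEOREMS ONLY)

WHAT.  The residual fact `Ribet1977_cmNewform_gamma0_badEulerFactor_padicCharacter` quantifies over an ARBITRARY framed character
`θ : Γ_K → GL₁(𝒪_{ℚ_p(S)})` pinned to `ψ` only at the primes `w ∤ p·𝔪` (unramified there, Frobenius charpoly `X − e⁻¹ψ(w)`); its conclusion at a
bad prime `ℓ ∣ |d_K|·N𝔪` involves the set `{w ∋ ℓ : θ unramified at w}` and the values `θ(Frob_w)₀₀` there — data the pin does not mention.  This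
file supplies them from the PRIMITIVE companion `(𝔠, ψ₀)` of `(𝔪, ψ)` (file 1, `exists_primitive_embCoeff_eq`; tree `IsGrossencharakter.exists_primitive`):
* `entry_eq_of_frobenius_eq` — **two integral rank-one framed representations (over possibly different coefficient rings `𝒪_S`, `𝒪_{S'}`) whose
  `(0,0)`-entries agree in `ℚ̄_p` at every arithmetic Frobenius outside a finite set of places agree EVERYWHERE** (push both to `GL₁(ℚ̄_p)` along the
  subring inclusions and apply the tree's Frobenius-density uniqueness `FramedGaloisRep.eq_or_eq_of_frobenius`: Chebotarev à la Serre I-2.2,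
  `absoluteGaloisGroup.frobenius_dense`);
* ★ `isUnramifiedAt_iff_and_entry_eq_of_pinned` — for `θ` pinned to `ψ` off `p·𝔪` and `(𝔠, ψ₀)` a Größencharakter datum with `𝔪 ⊆ 𝔠`, `ψ₀ = ψ`
  off `𝔪`, and SHARP modulus (the primes of `𝔠` are exactly the ramified places of every Hecke character realising `ψ₀`): at every prime `w ∌ p`,
  **`θ` is unramified at `w` iff `𝔠 ⊄ 𝔭_w`, and then `θ(Frob_w)₀₀ = e⁻¹ψ₀(w)`** — by comparison with the J-char′ avatar of `(𝔠, ψ₀)`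
  (`SmallImageRttCharRoad.exists_integralPinnedCharacter_localShape_ram_of_isGrossencharakter`, honda g32 p830457: pinned off `p𝔠`, ramified
  at every prime of `𝔠` away from `p`).
File 3 (`…RibetBadEulerFactorOfNewness`) assembles the (BAD) identity from files 1–2.

HONEST SCOPE: count-NEUTRAL hygiene; nothing here closes a stub; crux L is a kernel theorem only modulo its cited print facts and crux M;
BSD is proved for NO curve.

References: [SerreAbelianLadic1968] Ch. I §2.2 Cor. 2 (a), §2.3; [Rajan2000] Thm. 1 (m = 1); [NeukirchANT1999] VII §6 (6.11)–(6.14);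
[Ribet1977Nebentypus] §3 Remark (3.5).
-/

set_option linter.dupNamespace false
set_option autoImplicit false

noncomputable section

open scoped NumberField MatrixGroups Topology
open NumberField IsDedekindDomain Polynomial Field Filter
open Literature.NumberTheory.GaloisRepresentations Literature.NumberTheory.EllipticCurves
  Literature.NumberTheory.EllipticCurves.ModularForms

namespace Summit.BirchSwinnertonDyer.BirchSwinnertonDyer.Theorems.RibetBadEulerFactor

variable {K : Type} [Field K] [NumberField K] {p : ℕ} [Fact p.Prime]

/-! ## §1 Rank-one framed representations are determined, as `ℚ̄_p`-valued characters, by almost all Frobenius values -/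

/-- The places above the rational prime `p` form a finite set. [cite: NeukirchANT1999, Ch. I (8.2)] -/
private theorem finite_setOf_natCast_mem (p : ℕ) [Fact p.Prime] :
    {v : HeightOneSpectrum (𝓞 K) | ((p : ℕ) : 𝓞 K) ∈ v.asIdeal}.Finite := by
  have hne : (Ideal.span {((p : ℕ) : 𝓞 K)} : Ideal (𝓞 K)) ≠ ⊥ := by
    rw [Ne, Ideal.span_singleton_eq_bot]
    exact_mod_cast (Fact.out : p.Prime).ne_zero
  refine (Ideal.finite_factors hne).subset fun v hv => ?_
  simp only [Set.mem_setOf_eq] at hv ⊢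
  rw [Ideal.dvd_iff_le, Ideal.span_singleton_le_iff_mem]
  exact hv

/-- The primes of a non-zero ideal form a finite set. [cite: NeukirchANT1999, Ch. I §3 (3.3)] -/
private theorem finite_setOf_le_asIdeal {𝔪 : Ideal (𝓞 K)} (h𝔪 : 𝔪 ≠ ⊥) :
    {v : HeightOneSpectrum (𝓞 K) | 𝔪 ≤ v.asIdeal}.Finite :=
  (Ideal.finite_factors h𝔪).subset fun v hv => by
    simp only [Set.mem_setOf_eq] at hv ⊢
    exact Ideal.dvd_iff_le.mpr hv

/-- **Frobenius-density uniqueness for integral rank-one characters, across coefficient rings.**  Let `θ : Γ_K → GL₁(𝒪_S)` and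
`θ' : Γ_K → GL₁(𝒪_{S'})` be framed representations (integers of two `p`-adic coefficient fields inside `ℚ̄_p`) whose `(0,0)`-entries agree in
`ℚ̄_p` at every arithmetic Frobenius above every place outside a finite set `T`.  Then their entries agree at EVERY `σ ∈ Γ_K`.  Proof: push both to
`GL₁(ℚ̄_p)` (continuous change of coefficients along the subring inclusions) and use the tree's `FramedGaloisRep.eq_or_eq_of_frobenius` (Frobenius
elements outside `T` are dense, Chebotarev; `ℚ̄_p` is Hausdorff). [cite: SerreAbelianLadic1968, Ch. I §2.2 Cor. 2 (a) and §2.3] [cite: Rajan2000, Thm. 1 (m = 1)] -/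
theorem entry_eq_of_frobenius_eq {S S' : Set (PadicAlgCl p)} (θ : FramedGaloisRep K (padicCoeffIntegers S) 1)
    (θ' : FramedGaloisRep K (padicCoeffIntegers S') 1) {T : Set (HeightOneSpectrum (𝓞 K))} (hT : T.Finite)
    (h : ∀ v ∉ T, ∀ 𝔓 ∈ v.primesAbove, ∀ σ : absoluteGaloisGroup K, IsArithFrobAt (𝓞 K) σ 𝔓 →
      ((((θ σ : GL (Fin 1) (padicCoeffIntegers S)) : Matrix (Fin 1) (Fin 1) (padicCoeffIntegers S)) 0 0 : padicCoeffIntegers S) :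
          PadicAlgCl p) =
        ((((θ' σ : GL (Fin 1) (padicCoeffIntegers S')) : Matrix (Fin 1) (Fin 1) (padicCoeffIntegers S')) 0 0 : padicCoeffIntegers S') :
          PadicAlgCl p))
    (σ : absoluteGaloisGroup K) :
    ((((θ σ : GL (Fin 1) (padicCoeffIntegers S)) : Matrix (Fin 1) (Fin 1) (padicCoeffIntegers S)) 0 0 : padicCoeffIntegers S) : PadicAlgCl p) =
      ((((θ' σ : GL (Fin 1) (padicCoeffIntegers S')) : Matrix (Fin 1) (Fin 1) (padicCoeffIntegers S')) 0 0 : padicCoeffIntegers S') :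
        PadicAlgCl p) := by
  -- change of coefficients `GL₁(R) → GL₁(ℚ̄_p)` along a subring inclusion, as a continuous monoid hom
  have hcont : ∀ R : Subring (PadicAlgCl p),
      Continuous (Units.map (RingHom.mapMatrix R.subtype : Matrix (Fin 1) (Fin 1) R →+* Matrix (Fin 1) (Fin 1) (PadicAlgCl p)).toMonoidHom :
        GL (Fin 1) R → GL (Fin 1) (PadicAlgCl p)) := fun R =>
    Continuous.units_map _ (continuous_id.matrix_map continuous_subtype_val)
  let ι : ∀ R : Subring (PadicAlgCl p), GL (Fin 1) R →ₜ* GL (Fin 1) (PadicAlgCl p) := fun R =>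
    { toMonoidHom := (Units.map (RingHom.mapMatrix R.subtype : Matrix (Fin 1) (Fin 1) R →+* Matrix (Fin 1) (Fin 1) (PadicAlgCl p)).toMonoidHom)
      continuous_toFun := hcont R }
  have hι : ∀ (R : Subring (PadicAlgCl p)) (u : GL (Fin 1) R),
      ((ι R u : GL (Fin 1) (PadicAlgCl p)) : Matrix (Fin 1) (Fin 1) (PadicAlgCl p)) 0 0 = (((u : Matrix (Fin 1) (Fin 1) R) 0 0 : R) : PadicAlgCl p) :=
    fun R u => rfl
  set ρ : FramedGaloisRep K (PadicAlgCl p) 1 := (ι (padicCoeffIntegers S)).comp θ with hρ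
  set ρ' : FramedGaloisRep K (PadicAlgCl p) 1 := (ι (padicCoeffIntegers S')).comp θ' with hρ'
  have hρσ : ∀ τ : absoluteGaloisGroup K, ((ρ τ : GL (Fin 1) (PadicAlgCl p)) : Matrix (Fin 1) (Fin 1) (PadicAlgCl p)) 0 0 =
      ((((θ τ : GL (Fin 1) (padicCoeffIntegers S)) : Matrix (Fin 1) (Fin 1) (padicCoeffIntegers S)) 0 0 : padicCoeffIntegers S) : PadicAlgCl p) :=
    fun τ => hι _ _
  have hρ'σ : ∀ τ : absoluteGaloisGroup K, ((ρ' τ : GL (Fin 1) (PadicAlgCl p)) : Matrix (Fin 1) (Fin 1) (PadicAlgCl p)) 0 0 =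
      ((((θ' τ : GL (Fin 1) (padicCoeffIntegers S')) : Matrix (Fin 1) (Fin 1) (padicCoeffIntegers S')) 0 0 : padicCoeffIntegers S') :
        PadicAlgCl p) :=
    fun τ => hι _ _
  -- rank one: a `1 × 1` invertible matrix is its `(0,0)` entry
  have hext : ∀ {u u' : GL (Fin 1) (PadicAlgCl p)},
      ((u : Matrix (Fin 1) (Fin 1) (PadicAlgCl p)) 0 0) = ((u' : Matrix (Fin 1) (Fin 1) (PadicAlgCl p)) 0 0) → u = u' := by
    intro u u' huu
    refine Units.ext (Matrix.ext fun i j => ?_)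
    rw [Subsingleton.elim i 0, Subsingleton.elim j 0]
    exact huu
  have hfrob : ∀ v ∉ T, ∀ 𝔓 ∈ v.primesAbove, ∀ τ : absoluteGaloisGroup K, IsArithFrobAt (𝓞 K) τ 𝔓 →
      ρ τ = ρ' τ ∨ ρ τ = ρ' τ := fun v hv 𝔓 h𝔓 τ hτ =>
    Or.inl (hext (by rw [hρσ, hρ'σ]; exact h v hv 𝔓 h𝔓 τ hτ))
  have hρρ' : ρ = ρ' := by
    rcases FramedGaloisRep.eq_or_eq_of_frobenius ρ ρ' ρ' hT hfrob with h' | h'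
    · exact h'
    · exact h'
  rw [← hρσ, ← hρ'σ, hρρ']

/-! ## §2 ★ The pinned avatar vs the primitive companion: ramification and Frobenius values away from `p` -/

/-- ★ **Ramification and Frobenius values of the pinned avatar away from `p`, through the primitive companion.**  Let `(𝔠, ψ₀)` be a
Größencharakter datum of type `(a, b)` with `𝔪 ⊆ 𝔠`, `ψ₀ = ψ` off `𝔪`, and SHARP modulus (the primes of `𝔠` are exactly the ramified places of
every Hecke character realising `ψ₀`) — e.g. the primitive companion of `(𝔪, ψ)` —, `e : ℚ̄_p ≃ ℂ`, and `θ : Γ_K → GL₁(𝒪_S)` a framed character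
which at every prime `w ∌ p`, `w ⊉ 𝔪` is unramified with Frobenius charpoly `X − e⁻¹ψ(w)`.  Then at every prime `w ∌ p`:
`θ` is unramified at `w` iff `𝔠 ⊄ 𝔭_w`; and if `𝔠 ⊄ 𝔭_w` then `θ(F)₀₀ = e⁻¹ψ₀(w)` for every arithmetic Frobenius `F` above `w`.  Proof: the
J-char′ avatar `θ'` of `(𝔠, ψ₀)` (pinned off `p𝔠`, ramified at the primes of `𝔠` away from `p`) has the same Frobenius entries as `θ` off `p𝔪`,
hence the same entries everywhere (§1); read ramification and values on `θ'`.
[cite: SerreAbelianLadic1968, Ch. I §2.2 Cor. 2 (a), Ch. III §2.3] [cite: NeukirchANT1999, Ch. VII §6 Cor. (6.14)] [cite: Ribet1977Nebentypus, §3 Remark (3.5)] -/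
theorem isUnramifiedAt_iff_and_entry_eq_of_pinned (e : PadicAlgCl p ≃+* ℂ) {𝔪 𝔠 : Ideal (𝓞 K)} (h𝔪 : 𝔪 ≠ ⊥) (h𝔠 : 𝔠 ≠ ⊥)
    (h𝔪𝔠 : 𝔪 ≤ 𝔠) {a b : InfinitePlace K → ℤ} {ψ ψ₀ : HeightOneSpectrum (𝓞 K) → ℂ} (hψ₀ : IsGrossencharakter 𝔠 a b ψ₀)
    (heq : ∀ v : HeightOneSpectrum (𝓞 K), ¬ 𝔪 ≤ v.asIdeal → ψ₀ v = ψ v)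
    (hsharp : ∀ χ : HeckeCharacter K, (∀ᶠ v in cofinite, χ.valueAtUniformizer v = ψ₀ v) →
      ∀ w : HeightOneSpectrum (𝓞 K), 𝔠 ≤ w.asIdeal ↔ ¬ χ.IsUnramifiedAt w)
    {S : Set (PadicAlgCl p)} (θ : FramedGaloisRep K (padicCoeffIntegers S) 1)
    (hθ : ∀ w : HeightOneSpectrum (𝓞 K), ((p : ℕ) : 𝓞 K) ∉ w.asIdeal → ¬ 𝔪 ≤ w.asIdeal →
      θ.IsUnramifiedAt w ∧ ∃ P : Polynomial (padicCoeffIntegers S),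
        P.map (padicCoeffIntegers S).subtype = X - C (e.symm (ψ w)) ∧ θ.HasFrobCharpolyAt w P)
    (w : HeightOneSpectrum (𝓞 K)) (hwp : ((p : ℕ) : 𝓞 K) ∉ w.asIdeal) :
    (θ.IsUnramifiedAt w ↔ ¬ 𝔠 ≤ w.asIdeal) ∧
    (¬ 𝔠 ≤ w.asIdeal → ∀ 𝔓 ∈ w.primesAbove, ∀ F : absoluteGaloisGroup K, IsArithFrobAt (𝓞 K) F 𝔓 →
      ((((θ F : GL (Fin 1) (padicCoeffIntegers S)) : Matrix (Fin 1) (Fin 1) (padicCoeffIntegers S)) 0 0 : padicCoeffIntegers S) :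
        PadicAlgCl p) = e.symm (ψ₀ w)) := by
  classical
  -- the J-char′ avatar of the primitive companion
  obtain ⟨S', -, θ', hgood', -, hram'⟩ :=
    SmallImageRttCharRoad.exists_integralPinnedCharacter_localShape_ram_of_isGrossencharakter h𝔠 hψ₀ hsharp e
  -- `θ` and `θ'` have the same Frobenius entries off `p·𝔪`
  have hT : ({v : HeightOneSpectrum (𝓞 K) | ((p : ℕ) : 𝓞 K) ∈ v.asIdeal} ∪ {v | 𝔪 ≤ v.asIdeal}).Finite :=
    (finite_setOf_natCast_mem p).union (finite_setOf_le_asIdeal h𝔪)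
  have hagree : ∀ v ∉ ({v : HeightOneSpectrum (𝓞 K) | ((p : ℕ) : 𝓞 K) ∈ v.asIdeal} ∪ {v | 𝔪 ≤ v.asIdeal}),
      ∀ 𝔓 ∈ v.primesAbove, ∀ σ : absoluteGaloisGroup K, IsArithFrobAt (𝓞 K) σ 𝔓 →
      ((((θ σ : GL (Fin 1) (padicCoeffIntegers S)) : Matrix (Fin 1) (Fin 1) (padicCoeffIntegers S)) 0 0 : padicCoeffIntegers S) :
          PadicAlgCl p) =
        ((((θ' σ : GL (Fin 1) (padicCoeffIntegers S')) : Matrix (Fin 1) (Fin 1) (padicCoeffIntegers S')) 0 0 : padicCoeffIntegers S') :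
          PadicAlgCl p) := by
    intro v hv 𝔓 h𝔓 σ hσ
    simp only [Set.mem_union, Set.mem_setOf_eq, not_or] at hv
    obtain ⟨hvp, hv𝔪⟩ := hv
    have hv𝔠 : ¬ 𝔠 ≤ v.asIdeal := fun h => hv𝔪 (h𝔪𝔠.trans h)
    obtain ⟨-, P, hP, hθP⟩ := hθ v hvp hv𝔪
    obtain ⟨-, P', hP', hθP'⟩ := hgood' v hvp hv𝔠
    rw [coe_apply_zero_zero_eq_of_hasFrobCharpolyAt θ hP hθP h𝔓 hσ, coe_apply_zero_zero_eq_of_hasFrobCharpolyAt θ' hP' hθP' h𝔓 hσ, heq v hv𝔪]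
  have hall := entry_eq_of_frobenius_eq θ θ' hT hagree
  -- rank one: `u = 1 ↔ u₀₀ = 1`
  have hone : ∀ {R : Subring (PadicAlgCl p)} (u : GL (Fin 1) R),
      u = 1 ↔ ((((u : Matrix (Fin 1) (Fin 1) R) 0 0 : R)) : PadicAlgCl p) = 1 := by
    intro R u
    constructor
    · intro hu; rw [hu]; simp
    · intro hu
      refine Units.ext (Matrix.ext fun i j => ?_)
      rw [Subsingleton.elim i 0, Subsingleton.elim j 0, Units.val_one, Matrix.one_apply_eq]
      exact Subtype.ext (by simpa using hu)
  refine ⟨⟨fun hunr => ?_, fun hw𝔠 => ?_⟩, fun hw𝔠 𝔓 h𝔓 F hF => ?_⟩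
  · -- unramified `θ` ⇒ unramified `θ'` ⇒ `w` is not a prime of `𝔠`
    by_contra hle
    obtain ⟨𝔓, h𝔓, τ, hτ, hne⟩ := hram' w hle hwp
    apply hne
    have h1 : θ τ = 1 := hunr 𝔓 h𝔓 τ hτ
    have h2 : ((((θ τ : GL (Fin 1) (padicCoeffIntegers S)) : Matrix (Fin 1) (Fin 1) (padicCoeffIntegers S)) 0 0 :
        padicCoeffIntegers S) : PadicAlgCl p) = 1 := (hone _).mp h1
    rw [hall τ] at h2
    exact Subtype.ext (by simpa using h2)
  · -- `w ∤ 𝔠`: `θ'` is unramified at `w`, hence so is `θ`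
    intro 𝔓 h𝔓 τ hτ
    obtain ⟨hunr', -⟩ := hgood' w hwp hw𝔠
    have h1 : θ' τ = 1 := hunr' 𝔓 h𝔓 τ hτ
    exact (hone _).mpr (by rw [hall τ]; exact (hone _).mp h1)
  · -- the Frobenius value
    obtain ⟨-, P', hP', hθP'⟩ := hgood' w hwp hw𝔠
    rw [hall F, coe_apply_zero_zero_eq_of_hasFrobCharpolyAt θ' hP' hθP' h𝔓 hF]

end Summit.BirchSwinnertonDyer.BirchSwinnertonDyer.Theorems.RibetBadEulerFactor

end
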